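import Summits.BirchSwinnertonDyer.BirchSwinnertonDyer.Theses.GenusKolyvaginAtTwo
import Summits.BirchSwinnertonDyer.BirchSwinnertonDyer.Theorems.GenusKolyvaginAtTwoMinimalTwinBSDTwoAnalyticTwinNoTwoTorsion
import HarnessLib

/-!
# LINE 23 «twin_swap» v2.6 PROPOSAL «RE-KEYED TO U₂′» (FIVE stubs: WALL row 1 · DIV′ · NDIV′ · KEX⁰|Ш-cell · PRINT×6) — lever continuity for the
# director's (726) re-cut U₂ → U₂′ = «non-CM, r_an = 1, W(ℚ)[2] = 0 ⟹ BSD₂» (stmt-BirchSwinnertonDyer-22985 restated in place), route GenusKolyvaginAtTwo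

Seat `bsd-line-gk2-p2` g30 (PROVER 2/3, cell bsd-f1-sign2, LINE 23 holder), 2026-08-31.  **A PROPOSAL, NOT (yet) the registered skeleton**: v2.5
(`Lines/twin_swap.lean`, 0c6111283b4b) stays the line of record on the CURRENT text of 22985 (`#Sel₂(W) = 2`).  Nothing here proves BSD, U₂, U₂′, the
wall, DIV′, NDIV′ or the Ш-cell stub.

WHY.  Director-bsd (726): the pen prepares ONE route edit (rev 68) re-cutting the rank-one half of the leaf as U₂′ ∧ R″ (U₂′ = `MinimalTwinBSDTwo`'s text
with `Nat.card (W.selmerGroup 2) = 2` REPLACED by `∀ P, 2 • P = 0 → P = 0`; R″ = the torsion cell), lossless by LEAD g31's p798939; packet item (C) LEVER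
CONTINUITY asks how LINE 23 follows the slice.  THIS FILE is the line holder's answer, kernel-checked against rev 67:
* the four v2.5 stubs VERBATIM (WALL · DIV′ `HeegnerIndexUpperAnyTwinAtTwo` · NDIV′ `HeegnerIndexLowerAnyTwinAtTwo` · PRINT×6) still conclude the CURRENT
  crux `MinimalTwinBSDTwo` BY NAME (`MinimalTwinBSDTwo_of`, v2.5's composition unchanged) — so registering this file before rev 68 changes nothing for U₂;
* ONE new research stub for the slice that moves in: **KEX⁰|Ш-cell** `HeegnerIndexRelationShaCellAtTwo` := LEAD g31's KEX⁰ (= KEX′ with the Selmer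
  clause replaced by `W(ℚ)[2] = 0`, `…AnalyticTwinNoTwoTorsion` p796542) RESTRICTED to `#Sel₂(W) ≠ 2` — i.e. the 2-primary Gross–Zagier index relation
  `#Ш(W_K)[2^∞]·4^{ord₂ c + ord₂ C(W)} = 4^{M₀}` for the rank-one curves with `W(ℚ)[2] = 0` and `Ш(W)[2] ≠ 0` (there `Ш(W)[2^∞] ⊆ Ш(W_K)[2^∞]` is
  non-trivial, so `M₀ ≥ 1`: deeper than U₂'s cells; BSD-true; beyond print at 2 like DIV′/NDIV′);
* kernel: `kex0_of_kex_of_shaCell` (KEX′ ∧ KEX⁰|Ш-cell ⟹ KEX⁰, case split on `#Sel₂ = 2`), `kex_and_shaCell_of_kex0` (converse, GZK for `#Sel₂ = 2 ⟹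
  W(ℚ)[2] = 0`), hence **U₂′ ⟸ S1′ + DIV′ + NDIV′ + KEX⁰|Ш-cell + PRINT×6** (`rankOneNoTwoTorsionBSDTwo_of_inputs`, via LEAD's
  `NoTwoTorsion.bsdp_of_wall_of_friedbergHoffstein_of_kex0_of_facts`) and LOSSLESS (`shaCell_of_rankOneNoTwoTorsionBSDTwo_of_wall_of_facts`: U₂′ + S1′ +
  PRINT ⟹ KEX⁰|Ш-cell, from LEAD's `kex0_of_rankOneNoTwoTorsionBSDTwo_of_wall_of_facts`); `RankOneNoTwoTorsionBSDTwo_of_stubs` concludes the U₂′ TEXT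
  from the five stubs; `minimalTwinBSDTwo_of_rankOneNoTwoTorsionBSDTwo` (U₂ ⟸ U₂′ + GZK).
AFTER rev 68 (when 22985's decl carries the U₂′ text): the holder re-points `MinimalTwinBSDTwo_of` at `RankOneNoTwoTorsionBSDTwo_of_stubs` (one line),
`ledger skeleton check`s this file as v2.6 and `crux write`s it to `Lines/twin_swap.lean`.  If the pen instead keeps U₂ as a NODE under U₂′ with a proved
split, the node's glue is `kex0_of_kex_of_shaCell` / `rankOneNoTwoTorsionBSDTwo_of_inputs` and the Ш-cell stub is the ONE new item's text.
The four WALL rows are spelled `Theses.ByReductionTypeAtTwo.*` (their home decls = items 19095–19098; rename-proof after (708)/(709)).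
-/

set_option linter.dupNamespace false -- `Summit.<P>.<Sub>` repeats `BirchSwinnertonDyer` (D-0017)


namespace Summit.BirchSwinnertonDyer.BirchSwinnertonDyer.Cruxes.MinimalTwinBSDTwo.TwinSwapV26

open scoped Classical NumberField

open Summit.BirchSwinnertonDyer.BirchSwinnertonDyer.Theses.GenusKolyvaginAtTwo
open WeierstrassCurve NumberField Literature.NumberTheory.EllipticCurves Literature.NumberTheory.EllipticCurves.ModularForms
open Summit.BirchSwinnertonDyer.BirchSwinnertonDyer.Theorems
open Summit.BirchSwinnertonDyer.BirchSwinnertonDyer.Theorems.GenusExact.TwinSwap.AnalyticTwin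
  (bsdp_of_wall_of_friedbergHoffstein_of_kex_of_facts kexAny_of_minimalTwinBSDTwo_of_wall_of_facts)
open Summit.BirchSwinnertonDyer.BirchSwinnertonDyer.Theorems.GenusExact.TwinSwap.Ledger.Line25
  (not_isOfFinAddOrder_derivedPoint_one_of_rankOne_of_lValue_ne_zero)
open Summit.BirchSwinnertonDyer.BirchSwinnertonDyer.Theorems.KolyvaginAtTwo (exists_exactTwoDepth)
open Summit.BirchSwinnertonDyer.BirchSwinnertonDyer.Theorems.GenusExact.TwinSwap.AnalyticTwin.NoTwoTorsion
  (bsdp_of_wall_of_friedbergHoffstein_of_kex0_of_facts kex0_of_rankOneNoTwoTorsionBSDTwo_of_wall_of_facts)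
open Summit.BirchSwinnertonDyer.BirchSwinnertonDyer.Theorems.GenusExact.TwinSwap
  (rank_eq_one_and_sha_primary_eq_zero_of_natCard_selmerGroup_eq_two)
-- (g30, tree health after GK2 rev 65/66: the four WALL rows are named FULLY QUALIFIED below — `Theses.ByReductionTypeAtTwo.*`, their home decls =
-- items 19095–19098 — so that this file elaborates whether or not the GK2 Theses file carries local copies of those names.)

/-! ## The displayed Props (S1′ = WALL row 1 without the Selmer clause; KEX′ and its two halves DIV′, NDIV′) -/

/-- S1′ · the ANCHOR: BSD₂ for every non-CM globally minimal curve of analytic rank `0` (= WALL row 1 of route ByReductionTypeAtTwo, all four reduction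
types at `2`; no Selmer clause). -/
def RankZeroBSDTwo : Prop :=
  ∀ (W : WeierstrassCurve ℚ) [W.IsElliptic] [W.IsGloballyMinimal], ¬ W.HasCM → W.analyticRank = 0 →
    Literature.NumberTheory.EllipticCurves.BSDp W 2

/-- KEX′ (v2.4, VERBATIM) · the 2-primary Gross–Zagier index relation for the rank-one member at every odd Heegner frame with `2` split, any globally
minimal twin: SOME exact depth `2^{M₀} ∥ P(1)` has `#Ш(W_K)[2^∞] · 4^{ord₂ c + ord₂ C(W)} = 4^{M₀}`.  Derived below from DIV′ ∧ NDIV′; kept displayed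
because the v2.4 composition consumes it by this text. -/
def HeegnerIndexRelationAnyTwinAtTwo : Prop :=
  ∀ (W : WeierstrassCurve ℚ) [W.IsElliptic] [W.IsGloballyMinimal] [NeZero (W.conductorNorm ℤ)],
    ¬ W.HasCM → W.analyticRank = 1 → Nat.card (W.selmerGroup 2) = 2 →
    ∀ (K : Type) [Field K] [NumberField K], IsImaginaryQuadratic K →
      Odd (NumberField.discr K) → NumberField.discr K ≠ -3 → SatisfiesHeegnerHypothesis (W.conductorNorm ℤ) K →
      ((Ideal.span {(2 : ℤ)}).primesOver (𝓞 K)).ncard = 2 →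
      ∀ (Wd : WeierstrassCurve ℚ) [Wd.IsElliptic] [Wd.IsGloballyMinimal],
        (∃ C : VariableChange ℚ, C • W.quadraticTwist (NumberField.discr K : ℚ) = Wd) →
      (W.quadraticTwist (NumberField.discr K : ℚ)).entireLFunction 1 ≠ 0 →
      ∀ (Dt : ModularParametrizationData W (W.conductorNorm ℤ)) (β : ℤ) (ι : K →+* ℂ) (d₁ : KolyvaginHeegnerData Dt β ι 1),
        ∃ M₀ : ℕ,
          (∃ Q : (W.baseChange (ringClassField K ι 1)).toAffine.Point, ((2 ^ M₀ : ℕ) : ℤ) • Q = d₁.derivedPoint) ∧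
          (¬ ∃ Q : (W.baseChange (ringClassField K ι 1)).toAffine.Point, ((2 ^ (M₀ + 1) : ℕ) : ℤ) • Q = d₁.derivedPoint) ∧
          Nat.card (AddCommGroup.primaryComponent (W.baseChange K).sha 2) *
              2 ^ (2 * (padicValInt 2 Dt.c + padicValNat 2 W.tamagawaProduct)) = 2 ^ (2 * M₀)

/-- DIV′ · THE UPPER HALF (product-form Kolyvagin–Jetchev bound at `2` for the rank-one member): on the frame of KEX′, for EVERY exact depth `M₀` of
`P(1)` (`2^{M₀} ∣ P(1)`, `2^{M₀+1} ∤ P(1)` in `W(K[1])`): **`#Ш(W_K)[2^∞] · 4^{ord₂ c + ord₂ C(W)} ∣ 4^{M₀}`**.  Beyond print at `2` (and in product form at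
every `p`); contains the `n = 1` instance of crux 27467 on the slice 𝒮 (gk2-p2 g28).  At a (★)-frame (`M₀ = 0`) it reads
«`Ш(W_K)[2^∞] = 1 ∧ 2 ∤ c ∧ 2 ∤ C(W)`». -/
def HeegnerIndexUpperAnyTwinAtTwo : Prop :=
  ∀ (W : WeierstrassCurve ℚ) [W.IsElliptic] [W.IsGloballyMinimal] [NeZero (W.conductorNorm ℤ)],
    ¬ W.HasCM → W.analyticRank = 1 → Nat.card (W.selmerGroup 2) = 2 →
    ∀ (K : Type) [Field K] [NumberField K], IsImaginaryQuadratic K →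
      Odd (NumberField.discr K) → NumberField.discr K ≠ -3 → SatisfiesHeegnerHypothesis (W.conductorNorm ℤ) K →
      ((Ideal.span {(2 : ℤ)}).primesOver (𝓞 K)).ncard = 2 →
      ∀ (Wd : WeierstrassCurve ℚ) [Wd.IsElliptic] [Wd.IsGloballyMinimal],
        (∃ C : VariableChange ℚ, C • W.quadraticTwist (NumberField.discr K : ℚ) = Wd) →
      (W.quadraticTwist (NumberField.discr K : ℚ)).entireLFunction 1 ≠ 0 →
      ∀ (Dt : ModularParametrizationData W (W.conductorNorm ℤ)) (β : ℤ) (ι : K →+* ℂ) (d₁ : KolyvaginHeegnerData Dt β ι 1) (M₀ : ℕ),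
        (∃ Q : (W.baseChange (ringClassField K ι 1)).toAffine.Point, ((2 ^ M₀ : ℕ) : ℤ) • Q = d₁.derivedPoint) →
        (¬ ∃ Q : (W.baseChange (ringClassField K ι 1)).toAffine.Point, ((2 ^ (M₀ + 1) : ℕ) : ℤ) • Q = d₁.derivedPoint) →
          Nat.card (AddCommGroup.primaryComponent (W.baseChange K).sha 2) *
              2 ^ (2 * (padicValInt 2 Dt.c + padicValNat 2 W.tamagawaProduct)) ∣ 2 ^ (2 * M₀)

/-- NDIV′ · THE LOWER HALF (Kolyvagin NON-VANISHING at `2` for the rank-one member): on the frame of KEX′, for EVERY exact depth `M₀` of `P(1)`: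
**`4^{M₀} ∣ #Ш(W_K)[2^∞] · 4^{ord₂ c + ord₂ C(W)}`** — `y_K` is not more `2`-divisible than Ш, the Manin constant and the Tamagawa product allow.  Beyond
print at `2` (W. Zhang 2014 is `p ≥ 5`; the rank-lowering step is obstructed at `2`, Le Hung–Li 2016 Rem. 6); automatic at depth `M₀ = 0`. -/
def HeegnerIndexLowerAnyTwinAtTwo : Prop :=
  ∀ (W : WeierstrassCurve ℚ) [W.IsElliptic] [W.IsGloballyMinimal] [NeZero (W.conductorNorm ℤ)],
    ¬ W.HasCM → W.analyticRank = 1 → Nat.card (W.selmerGroup 2) = 2 →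
    ∀ (K : Type) [Field K] [NumberField K], IsImaginaryQuadratic K →
      Odd (NumberField.discr K) → NumberField.discr K ≠ -3 → SatisfiesHeegnerHypothesis (W.conductorNorm ℤ) K →
      ((Ideal.span {(2 : ℤ)}).primesOver (𝓞 K)).ncard = 2 →
      ∀ (Wd : WeierstrassCurve ℚ) [Wd.IsElliptic] [Wd.IsGloballyMinimal],
        (∃ C : VariableChange ℚ, C • W.quadraticTwist (NumberField.discr K : ℚ) = Wd) →
      (W.quadraticTwist (NumberField.discr K : ℚ)).entireLFunction 1 ≠ 0 →
      ∀ (Dt : ModularParametrizationData W (W.conductorNorm ℤ)) (β : ℤ) (ι : K →+* ℂ) (d₁ : KolyvaginHeegnerData Dt β ι 1) (M₀ : ℕ),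
        (∃ Q : (W.baseChange (ringClassField K ι 1)).toAffine.Point, ((2 ^ M₀ : ℕ) : ℤ) • Q = d₁.derivedPoint) →
        (¬ ∃ Q : (W.baseChange (ringClassField K ι 1)).toAffine.Point, ((2 ^ (M₀ + 1) : ℕ) : ℤ) • Q = d₁.derivedPoint) →
          2 ^ (2 * M₀) ∣ Nat.card (AddCommGroup.primaryComponent (W.baseChange K).sha 2) *
              2 ^ (2 * (padicValInt 2 Dt.c + padicValNat 2 W.tamagawaProduct))

/-! ## NEW in v2.6: the re-cut target U₂′ and the ONE new research stub KEX⁰|Ш-cell -/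

/-- U₂′ · THE RE-CUT CRUX TEXT (director-bsd (726); LEAD g31 p798939 `…Census.TorsionCell`): BSD₂ for every non-CM globally minimal curve of analytic
rank `1` WITHOUT rational `2`-torsion — `MinimalTwinBSDTwo`'s text with `Nat.card (W.selmerGroup 2) = 2` replaced by `W(ℚ)[2] = 0`; = U₂ ∪ the Ш-cell
of R′.  Displayed here so that the composition below concludes it VERBATIM; after rev 68 it is the text of item 22985. -/
def RankOneNoTwoTorsionBSDTwo : Prop :=
  ∀ (W : WeierstrassCurve ℚ) [W.IsElliptic] [W.IsGloballyMinimal],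
    ¬ W.HasCM → W.analyticRank = 1 → (∀ P : W.toAffine.Point, 2 • P = 0 → P = 0) → Literature.NumberTheory.EllipticCurves.BSDp W 2

/-- KEX⁰ (LEAD g31, `…AnalyticTwinNoTwoTorsion` §4 hypothesis, VERBATIM) · KEX′ with the Selmer clause replaced by `W(ℚ)[2] = 0`: the 2-primary
Gross–Zagier index relation for EVERY non-CM rank-one curve without rational `2`-torsion, at every odd Heegner frame with `2` split.  Derived below from
KEX′ (i.e. DIV′ ∧ NDIV′) and KEX⁰|Ш-cell; displayed because LEAD's engine consumes it by this text. -/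
def HeegnerIndexRelationNoTwoTorsionAtTwo : Prop :=
  ∀ (W : WeierstrassCurve ℚ) [W.IsElliptic] [W.IsGloballyMinimal] [NeZero (W.conductorNorm ℤ)],
    ¬ W.HasCM → W.analyticRank = 1 → (∀ P : W.toAffine.Point, 2 • P = 0 → P = 0) →
    ∀ (K : Type) [Field K] [NumberField K], IsImaginaryQuadratic K →
      Odd (NumberField.discr K) → NumberField.discr K ≠ -3 → SatisfiesHeegnerHypothesis (W.conductorNorm ℤ) K →
      ((Ideal.span {(2 : ℤ)}).primesOver (𝓞 K)).ncard = 2 →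
      ∀ (Wd : WeierstrassCurve ℚ) [Wd.IsElliptic] [Wd.IsGloballyMinimal],
        (∃ C : VariableChange ℚ, C • W.quadraticTwist (NumberField.discr K : ℚ) = Wd) →
      (W.quadraticTwist (NumberField.discr K : ℚ)).entireLFunction 1 ≠ 0 →
      ∀ (Dt : ModularParametrizationData W (W.conductorNorm ℤ)) (β : ℤ) (ι : K →+* ℂ) (d₁ : KolyvaginHeegnerData Dt β ι 1),
        ∃ M₀ : ℕ,
          (∃ Q : (W.baseChange (ringClassField K ι 1)).toAffine.Point, ((2 ^ M₀ : ℕ) : ℤ) • Q = d₁.derivedPoint) ∧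
          (¬ ∃ Q : (W.baseChange (ringClassField K ι 1)).toAffine.Point, ((2 ^ (M₀ + 1) : ℕ) : ℤ) • Q = d₁.derivedPoint) ∧
          Nat.card (AddCommGroup.primaryComponent (W.baseChange K).sha 2) *
              2 ^ (2 * (padicValInt 2 Dt.c + padicValNat 2 W.tamagawaProduct)) = 2 ^ (2 * M₀)

/-- **KEX⁰|Ш-cell · THE ONE NEW RESEARCH STUB of v2.6**: KEX⁰ restricted to the slice that the re-cut moves into the crux — rank-one non-CM curves with
`W(ℚ)[2] = 0` and `#Sel₂(W) ≠ 2` (equivalently `Ш(W)[2] ≠ 0`, `#Sel₂ ≥ 8`; LEAD `…NoTwoTorsionCensus.natCard_selmerGroup_two_ne_two_iff_of_analyticRank_one`).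
There `Ш(W)[2^∞] ≠ 1` sits inside `Ш(W_K)[2^∞]`, so the relation forces `M₀ ≥ 1`: the Heegner point is 2-DIVISIBLE by at least the Ш-bit — a depth the
minimal-twin cells never see.  BSD-true; beyond print at `2` (product-form Kolyvagin exactness, cf. DIV′/NDIV′). -/
def HeegnerIndexRelationShaCellAtTwo : Prop :=
  ∀ (W : WeierstrassCurve ℚ) [W.IsElliptic] [W.IsGloballyMinimal] [NeZero (W.conductorNorm ℤ)],
    ¬ W.HasCM → W.analyticRank = 1 → (∀ P : W.toAffine.Point, 2 • P = 0 → P = 0) → Nat.card (W.selmerGroup 2) ≠ 2 →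
    ∀ (K : Type) [Field K] [NumberField K], IsImaginaryQuadratic K →
      Odd (NumberField.discr K) → NumberField.discr K ≠ -3 → SatisfiesHeegnerHypothesis (W.conductorNorm ℤ) K →
      ((Ideal.span {(2 : ℤ)}).primesOver (𝓞 K)).ncard = 2 →
      ∀ (Wd : WeierstrassCurve ℚ) [Wd.IsElliptic] [Wd.IsGloballyMinimal],
        (∃ C : VariableChange ℚ, C • W.quadraticTwist (NumberField.discr K : ℚ) = Wd) →
      (W.quadraticTwist (NumberField.discr K : ℚ)).entireLFunction 1 ≠ 0 →
      ∀ (Dt : ModularParametrizationData W (W.conductorNorm ℤ)) (β : ℤ) (ι : K →+* ℂ) (d₁ : KolyvaginHeegnerData Dt β ι 1),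
        ∃ M₀ : ℕ,
          (∃ Q : (W.baseChange (ringClassField K ι 1)).toAffine.Point, ((2 ^ M₀ : ℕ) : ℤ) • Q = d₁.derivedPoint) ∧
          (¬ ∃ Q : (W.baseChange (ringClassField K ι 1)).toAffine.Point, ((2 ^ (M₀ + 1) : ℕ) : ℤ) • Q = d₁.derivedPoint) ∧
          Nat.card (AddCommGroup.primaryComponent (W.baseChange K).sha 2) *
              2 ^ (2 * (padicValInt 2 Dt.c + padicValNat 2 W.tamagawaProduct)) = 2 ^ (2 * M₀)

/-! ## The five stubs (WALL row 1 ×4 bundled · DIV′ · NDIV′ · KEX⁰|Ш-cell · PRINT ×6 bundled) -/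

/-- stub WALL = items `GoodOrdinaryRankZeroAtTwo` (stmt-BirchSwinnertonDyer-19095), `MultiplicativeRankZeroAtTwo`, `SupersingularRankZeroAtTwo`,
`AdditiveRankZeroAtTwo` (route ByReductionTypeAtTwo, WALL row 1) BY NAME — the anchor. -/
theorem stub_wallRankZeroAtTwo :
    Theses.ByReductionTypeAtTwo.GoodOrdinaryRankZeroAtTwo ∧ Theses.ByReductionTypeAtTwo.MultiplicativeRankZeroAtTwo ∧
      Theses.ByReductionTypeAtTwo.SupersingularRankZeroAtTwo ∧ Theses.ByReductionTypeAtTwo.AdditiveRankZeroAtTwo := by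
  sorry

/-- stub DIV′ — the upper half (product-form Kolyvagin–Jetchev bound at `2`, rank-one member; research). -/
theorem stub_heegnerIndexUpper : HeegnerIndexUpperAnyTwinAtTwo := by
  sorry

/-- stub NDIV′ — the lower half (Kolyvagin non-vanishing at `2`, rank-one member; research). -/
theorem stub_heegnerIndexLower : HeegnerIndexLowerAnyTwinAtTwo := by
  sorry

/-- stub KEX⁰|Ш-cell — NEW in v2.6: the index relation on the slice the re-cut moves in (`W(ℚ)[2] = 0`, `#Sel₂(W) ≠ 2`; research).  NOT used by
`MinimalTwinBSDTwo_of` (the current crux text); used by `RankOneNoTwoTorsionBSDTwo_of_stubs` (the rev-68 text). -/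
theorem stub_heegnerIndexRelationShaCell : HeegnerIndexRelationShaCellAtTwo := by
  sorry

/-- stub PRINT = the route's four print items BY NAME — `GrossZagierAllLevels` (24148), `MultPublishedInputsAtTwo` (19921 = GZK), `EntireLFunctionRat` (19273),
`MilneAnyModel` (24149) — + BCDT `nonempty_modularParametrizationData` + Friedberg–Hoffstein `friedbergHoffstein_exists_heegnerField_split_twist_ne_zero`
(both Literature statement-only facts, in print). -/
theorem stub_printFacts :
    GrossZagierAllLevels ∧ MultPublishedInputsAtTwo ∧ EntireLFunctionRat ∧ MilneAnyModel ∧ nonempty_modularParametrizationData ∧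
      friedbergHoffstein_exists_heegnerField_split_twist_ne_zero := by
  sorry

/-! ## Closed pieces: the S1′ door, uniqueness of the exact depth, KEX′ ⟺ DIV′ ∧ NDIV′, losslessness of both halves -/

/-- WALL row 1 (ByReductionTypeAtTwo 19095–19098) ⟹ S1′, by the reduction-type tetrachotomy at `2`. -/
theorem rankZeroBSDTwo_of_wall (hOrd : Theses.ByReductionTypeAtTwo.GoodOrdinaryRankZeroAtTwo)
    (hMult : Theses.ByReductionTypeAtTwo.MultiplicativeRankZeroAtTwo) (hSS : Theses.ByReductionTypeAtTwo.SupersingularRankZeroAtTwo)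
    (hAdd : Theses.ByReductionTypeAtTwo.AdditiveRankZeroAtTwo) : RankZeroBSDTwo := by
  intro W _ _ hCM hr
  by_cases hg : W.HasGoodReductionAtPrime 2
  · by_cases hd : ((2 : ℕ) : ℤ) ∣ W.frobeniusTrace 2
    · exact hSS W hCM hr ⟨hg, hd⟩
    · exact hOrd W hCM hr ⟨hg, hd⟩
  · by_cases hm : W.HasMultiplicativeReductionAtPrime 2
    · exact hMult W hCM hr hm
    · exact hAdd W hCM hr ⟨hg, hm⟩

/-- The exact `2`-depth of an element of an additive group is unique: `2^a ∥ y` and `2^b ∥ y` force `a = b`. [folklore] -/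
theorem exactTwoDepth_unique {A : Type*} [AddCommGroup A] {y : A} {a b : ℕ}
    (ha : ∃ Q : A, ((2 ^ a : ℕ) : ℤ) • Q = y) (ha' : ¬ ∃ Q : A, ((2 ^ (a + 1) : ℕ) : ℤ) • Q = y)
    (hb : ∃ Q : A, ((2 ^ b : ℕ) : ℤ) • Q = y) (hb' : ¬ ∃ Q : A, ((2 ^ (b + 1) : ℕ) : ℤ) • Q = y) : a = b := by
  by_contra hne
  rcases Nat.lt_or_gt_of_ne hne with h | h
  · obtain ⟨Q, hQ⟩ := hb
    exact ha' ⟨((2 ^ (b - (a + 1)) : ℕ) : ℤ) • Q, by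
      rw [smul_smul, ← hQ]; congr 1; rw [← Nat.cast_mul, ← pow_add]; congr 2; omega⟩
  · obtain ⟨Q, hQ⟩ := ha
    exact hb' ⟨((2 ^ (a - (b + 1)) : ℕ) : ℤ) • Q, by
      rw [smul_smul, ← hQ]; congr 1; rw [← Nat.cast_mul, ← pow_add]; congr 2; omega⟩

/-- **KEX′ ⟸ DIV′ ∧ NDIV′** (modulo Gross–Zagier + modularity, used only to know that `P(1)` has infinite order, so that its exact `2`-depth in the finitely
generated group `W(K[1])` EXISTS — `KolyvaginAtTwo.exists_exactTwoDepth`): at that depth the two divisibilities give the equality by `Nat.dvd_antisymm`.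
[cite: GrossZagier1986, V.§2 (2.2)] [cite: McCallumLMS1991, §5 Lemma 5.1 (proof: «M₀ is finite»)] -/
theorem heegnerIndexRelation_of_halves
    (hGZ : ∀ (N : ℕ) [NeZero N] (W : WeierstrassCurve ℚ) (K : Type) [Field K] [NumberField K], gross_zagier N W K)
    (hmod : hasEntireLFunction_rat)
    (hU : HeegnerIndexUpperAnyTwinAtTwo) (hL : HeegnerIndexLowerAnyTwinAtTwo) : HeegnerIndexRelationAnyTwinAtTwo := by
  intro W _ _ _ hcm hr hSel K _ _ hK hodd h3 hH h2K Wd _ _ hWd hLv Dt β ι d₁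
  -- `P(1)` has infinite order (Gross–Zagier); its exact `2`-depth exists (Mordell–Weil over `K[1]`)
  have hy : ¬ IsOfFinAddOrder d₁.derivedPoint :=
    not_isOfFinAddOrder_derivedPoint_one_of_rankOne_of_lValue_ne_zero hmod W K (hGZ _ W K) hK hH hr hLv d₁
  haveI := (finiteDimensional_and_isGalois_ringClassField hK ι one_ne_zero).1
  haveI : NumberField (ringClassField K ι 1) := NumberField.of_module_finite K _
  haveI : (W.baseChange (ringClassField K ι 1)).IsElliptic := by rw [baseChange]; infer_instance
  haveI : Module.Finite ℤ (W.baseChange (ringClassField K ι 1)).toAffine.Point := by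
    convert (W.baseChange (ringClassField K ι 1)).module_finite_point_holds
  obtain ⟨M₀, hdiv, hndiv⟩ := exists_exactTwoDepth
    (A := (W.baseChange (ringClassField K ι 1)).toAffine.Point) (y := d₁.derivedPoint) (by convert hy)
  exact ⟨M₀, hdiv, hndiv, Nat.dvd_antisymm (hU W hcm hr hSel K hK hodd h3 hH h2K Wd hWd hLv Dt β ι d₁ M₀ hdiv hndiv)
    (hL W hcm hr hSel K hK hodd h3 hH h2K Wd hWd hLv Dt β ι d₁ M₀ hdiv hndiv)⟩

/-- **DIV′ ∧ NDIV′ ⟸ KEX′** (unconditional: the exact depth is unique, so KEX′'s equality holds at EVERY exact depth). [folklore] -/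
theorem halves_of_heegnerIndexRelation (hKEX : HeegnerIndexRelationAnyTwinAtTwo) :
    HeegnerIndexUpperAnyTwinAtTwo ∧ HeegnerIndexLowerAnyTwinAtTwo := by
  refine ⟨?_, ?_⟩
  · intro W _ _ _ hcm hr hSel K _ _ hK hodd h3 hH h2K Wd _ _ hWd hLv Dt β ι d₁ M₀ hdiv hndiv
    obtain ⟨M₁, hdiv₁, hndiv₁, heq⟩ := hKEX W hcm hr hSel K hK hodd h3 hH h2K Wd hWd hLv Dt β ι d₁
    rw [exactTwoDepth_unique hdiv hndiv hdiv₁ hndiv₁, ← heq]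
  · intro W _ _ _ hcm hr hSel K _ _ hK hodd h3 hH h2K Wd _ _ hWd hLv Dt β ι d₁ M₀ hdiv hndiv
    obtain ⟨M₁, hdiv₁, hndiv₁, heq⟩ := hKEX W hcm hr hSel K hK hodd h3 hH h2K Wd hWd hLv Dt β ι d₁
    rw [exactTwoDepth_unique hdiv hndiv hdiv₁ hndiv₁, ← heq]

/-- **NDIV′ is automatic at depth zero**: the lower half's conclusion at `M₀ = 0` is `1 ∣ _` — so at every frame where `P(1) ∉ 2W(K[1])` (in particular
every Kriz–Li (★)-certified frame, g24 `Star.twoDivExponent_clauses_zero_of_assumptionStar`) only DIV′ carries content. [folklore] -/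
theorem heegnerIndexLower_frame_of_depthZero (a b : ℕ) : 2 ^ (2 * 0) ∣ a * 2 ^ b := by
  simp

/-- ★ **BOTH HALVES ARE LOSSLESS: U₂ + S1′ + PRINT ⟹ DIV′ ∧ NDIV′** (g27's `AnalyticTwin.kexAny_of_minimalTwinBSDTwo_of_wall_of_facts` + uniqueness of the
exact depth).  So modulo the wall and PRINT, `MinimalTwinBSDTwo ⟺ DIV′ ∧ NDIV′`; neither half is a weakening of the crux.  CONDITIONAL; closes nothing.
[cite: GrossZagier1986, V.§2 (2.2)] [cite: Milne1972ArithmeticAV, §1 Thm. 1] -/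
theorem halves_of_minimalTwinBSDTwo_of_wall_of_facts
    (hGZ : ∀ (N : ℕ) [NeZero N] (W : WeierstrassCurve ℚ) (K : Type) [Field K] [NumberField K], gross_zagier N W K)
    (hGZK : rank_eq_analyticRank_of_analyticRank_le_one) (hmod : hasEntireLFunction_rat)
    (hMilneC : Milne1972.bsdQuotient_baseChange_quadratic_anyModel) (h1 : RankZeroBSDTwo)
    (hTw : Summit.BirchSwinnertonDyer.BirchSwinnertonDyer.Theses.GenusKolyvaginAtTwo.MinimalTwinBSDTwo) :
    HeegnerIndexUpperAnyTwinAtTwo ∧ HeegnerIndexLowerAnyTwinAtTwo :=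
  halves_of_heegnerIndexRelation (kexAny_of_minimalTwinBSDTwo_of_wall_of_facts hGZ hGZK hmod hMilneC h1 hTw)

/-! ## NEW in v2.6: KEX⁰ ⟺ KEX′ ∧ KEX⁰|Ш-cell; U₂′ from the five stubs; losslessness of the new stub; U₂ ⟸ U₂′ -/

/-- **KEX⁰ ⟸ KEX′ ∧ KEX⁰|Ш-cell** (case split on `#Sel₂(W) = 2`; KEX′ does not use the torsion hypothesis). [folklore] -/
theorem kex0_of_kex_of_shaCell (hKEX : HeegnerIndexRelationAnyTwinAtTwo) (hSha : HeegnerIndexRelationShaCellAtTwo) :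
    HeegnerIndexRelationNoTwoTorsionAtTwo := by
  intro W _ _ _ hcm hr hT2 K _ _ hK hodd h3 hH h2K Wd _ _ hWd hLv Dt β ι d₁
  by_cases hSel : Nat.card (W.selmerGroup 2) = 2
  · exact hKEX W hcm hr hSel K hK hodd h3 hH h2K Wd hWd hLv Dt β ι d₁
  · exact hSha W hcm hr hT2 hSel K hK hodd h3 hH h2K Wd hWd hLv Dt β ι d₁

/-- **KEX⁰|Ш-cell ⟸ KEX⁰** (restriction). [folklore] -/
theorem shaCell_of_kex0 (h0 : HeegnerIndexRelationNoTwoTorsionAtTwo) : HeegnerIndexRelationShaCellAtTwo :=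
  fun W _ _ _ hcm hr hT2 _ K _ _ hK hodd h3 hH h2K Wd _ _ hWd hLv Dt β ι d₁ ↦ h0 W hcm hr hT2 K hK hodd h3 hH h2K Wd hWd hLv Dt β ι d₁

/-- **KEX′ ⟸ KEX⁰** modulo Gross–Zagier–Kolyvagin (`#Sel₂(W) = 2` with `rank W(ℚ) ≥ 1` forces `W(ℚ)[2] = 0`, Silverman X.4.2 count).
[cite: SilvermanAEC2009, Thm. X.4.2] -/
theorem kex_of_kex0 (hGZK : rank_eq_analyticRank_of_analyticRank_le_one) (h0 : HeegnerIndexRelationNoTwoTorsionAtTwo) :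
    HeegnerIndexRelationAnyTwinAtTwo := by
  intro W _ _ _ hcm hr hSel K _ _ hK hodd h3 hH h2K Wd _ _ hWd hLv Dt β ι d₁
  have hrk : 1 ≤ W.mordellWeilRank := by rw [(hGZK W (le_of_eq hr)).1, hr]
  obtain ⟨-, hT2, -⟩ := rank_eq_one_and_sha_primary_eq_zero_of_natCard_selmerGroup_eq_two W hSel hrk
  exact h0 W hcm hr (fun P hP ↦ by convert hT2 P (by convert hP)) K hK hodd h3 hH h2K Wd hWd hLv Dt β ι d₁

/-- **COMPOSITION for U₂′ with displayed inputs**: S1′ + DIV′ + NDIV′ + KEX⁰|Ш-cell + PRINT×6 prove the re-cut text U₂′ (unfolded) — LEAD g31's Selmer-free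
engine `NoTwoTorsion.bsdp_of_wall_of_friedbergHoffstein_of_kex0_of_facts` fed with KEX⁰ := `kex0_of_kex_of_shaCell (heegnerIndexRelation_of_halves …) …`.
CONDITIONAL on every displayed hypothesis; proves nothing about BSD; closes nothing.
[cite: FriedbergHoffstein1995, main theorem] [cite: GrossZagier1986, V.§2 (2.2)] [cite: Milne1972ArithmeticAV, §1 Thm. 1] -/
theorem rankOneNoTwoTorsionBSDTwo_of_inputs (h1 : RankZeroBSDTwo) (hU : HeegnerIndexUpperAnyTwinAtTwo) (hL : HeegnerIndexLowerAnyTwinAtTwo)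
    (hSha : HeegnerIndexRelationShaCellAtTwo)
    (hGZ : GrossZagierAllLevels) (hGZK : MultPublishedInputsAtTwo) (hLf : EntireLFunctionRat) (hMi : MilneAnyModel)
    (hMP : nonempty_modularParametrizationData) (hFH : friedbergHoffstein_exists_heegnerField_split_twist_ne_zero) :
    ∀ (W : WeierstrassCurve ℚ) [W.IsElliptic] [W.IsGloballyMinimal],
      ¬ W.HasCM → W.analyticRank = 1 → (∀ P : W.toAffine.Point, 2 • P = 0 → P = 0) → Literature.NumberTheory.EllipticCurves.BSDp W 2 :=
  bsdp_of_wall_of_friedbergHoffstein_of_kex0_of_facts hGZ hGZK hLf hMi hMP hFH h1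
    (kex0_of_kex_of_shaCell (heegnerIndexRelation_of_halves hGZ hLf hU hL) hSha)

/-- ★ **THE NEW STUB IS LOSSLESS: U₂′ + S1′ + PRINT ⟹ KEX⁰|Ш-cell** (LEAD's `kex0_of_rankOneNoTwoTorsionBSDTwo_of_wall_of_facts`, restricted).  So modulo
WALL row 1 + PRINT the five-stub line is EQUIVALENT to U₂′ (with `halves_of_minimalTwinBSDTwo_of_wall_of_facts` for DIV′/NDIV′ and U₂ ⟸ U₂′ below).
CONDITIONAL; closes nothing. [cite: GrossZagier1986, V.§2 (2.2)] [cite: Milne1972ArithmeticAV, §1 Thm. 1] -/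
theorem shaCell_of_rankOneNoTwoTorsionBSDTwo_of_wall_of_facts
    (hGZ : ∀ (N : ℕ) [NeZero N] (W : WeierstrassCurve ℚ) (K : Type) [Field K] [NumberField K], gross_zagier N W K)
    (hGZK : rank_eq_analyticRank_of_analyticRank_le_one) (hmod : hasEntireLFunction_rat)
    (hMilneC : Milne1972.bsdQuotient_baseChange_quadratic_anyModel) (h1 : RankZeroBSDTwo) (hU2' : RankOneNoTwoTorsionBSDTwo) :
    HeegnerIndexRelationShaCellAtTwo :=
  shaCell_of_kex0 (kex0_of_rankOneNoTwoTorsionBSDTwo_of_wall_of_facts hGZ hGZK hmod hMilneC h1 hU2')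

/-- **U₂ ⟸ U₂′** modulo Gross–Zagier–Kolyvagin (`#Sel₂(W) = 2` at analytic rank `1` ⟹ `W(ℚ)[2] = 0`). [cite: SilvermanAEC2009, Thm. X.4.2] -/
theorem minimalTwinBSDTwo_of_rankOneNoTwoTorsionBSDTwo (hGZK : rank_eq_analyticRank_of_analyticRank_le_one) (hU2' : RankOneNoTwoTorsionBSDTwo) :
    ∀ (W : WeierstrassCurve ℚ) [W.IsElliptic] [W.IsGloballyMinimal],
      ¬ W.HasCM → W.analyticRank = 1 → Nat.card (W.selmerGroup 2) = 2 → Literature.NumberTheory.EllipticCurves.BSDp W 2 := by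
  intro W _ _ hcm hr hSel
  have hrk : 1 ≤ W.mordellWeilRank := by rw [(hGZK W (le_of_eq hr)).1, hr]
  obtain ⟨-, hT2, -⟩ := rank_eq_one_and_sha_primary_eq_zero_of_natCard_selmerGroup_eq_two W hSel hrk
  exact hU2' W hcm hr (fun P hP ↦ by convert hT2 P (by convert hP))

/-- ★ **THE RE-CUT TEXT U₂′ FROM THE FIVE STUBS** — WALL row 1 (items, bundled), DIV′, NDIV′, KEX⁰|Ш-cell, PRINT×6 (bundled).  After rev 68 the line
holder re-points `MinimalTwinBSDTwo_of` at this theorem (the item's decl then carries exactly this text).  Sorry-free outside the stubs. -/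
theorem RankOneNoTwoTorsionBSDTwo_of_stubs : RankOneNoTwoTorsionBSDTwo :=
  rankOneNoTwoTorsionBSDTwo_of_inputs
    (rankZeroBSDTwo_of_wall stub_wallRankZeroAtTwo.1 stub_wallRankZeroAtTwo.2.1 stub_wallRankZeroAtTwo.2.2.1 stub_wallRankZeroAtTwo.2.2.2)
    stub_heegnerIndexUpper stub_heegnerIndexLower stub_heegnerIndexRelationShaCell
    stub_printFacts.1 stub_printFacts.2.1 stub_printFacts.2.2.1 stub_printFacts.2.2.2.1 stub_printFacts.2.2.2.2.1 stub_printFacts.2.2.2.2.2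

/-! ## The composition -/

/-- COMPOSITION v2.5 with displayed inputs (kernel-checked, no sorry of its own): S1′ + DIV′ + NDIV′ + PRINT×6 prove hTw BY NAME — ONE cell, no converse,
no residual (v2.4's `AnalyticTwin.bsdp_of_wall_of_friedbergHoffstein_of_kex_of_facts` fed with KEX′ := `heegnerIndexRelation_of_halves`). -/
theorem minimalTwinBSDTwo_of_inputs (h1 : RankZeroBSDTwo) (hU : HeegnerIndexUpperAnyTwinAtTwo) (hL : HeegnerIndexLowerAnyTwinAtTwo)
    (hGZ : GrossZagierAllLevels) (hGZK : MultPublishedInputsAtTwo) (hLf : EntireLFunctionRat) (hMi : MilneAnyModel)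
    (hMP : nonempty_modularParametrizationData) (hFH : friedbergHoffstein_exists_heegnerField_split_twist_ne_zero) :
    -- (= `MinimalTwinBSDTwo` unfolded, so that `MinimalTwinBSDTwo_of` below is the FIRST theorem concluding the crux decl by name)
    ∀ (W : WeierstrassCurve ℚ) [W.IsElliptic] [W.IsGloballyMinimal],
      ¬ W.HasCM → W.analyticRank = 1 → Nat.card (W.selmerGroup 2) = 2 → Literature.NumberTheory.EllipticCurves.BSDp W 2 :=
  bsdp_of_wall_of_friedbergHoffstein_of_kex_of_facts hGZ hGZK hLf hMi hMP hFH h1 (heegnerIndexRelation_of_halves hGZ hLf hU hL)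

/-- **THE LINE CONCLUDES THE CRUX BY NAME**: `MinimalTwinBSDTwo` (stmt-BirchSwinnertonDyer-22985) from the four stubs — WALL row 1 (items, bundled), DIV′,
NDIV′, PRINT×6 (bundled).  Sorry-free outside the stubs; no converse, no residual locus. -/
theorem MinimalTwinBSDTwo_of : Summit.BirchSwinnertonDyer.BirchSwinnertonDyer.Theses.GenusKolyvaginAtTwo.MinimalTwinBSDTwo :=
  minimalTwinBSDTwo_of_inputs
    (rankZeroBSDTwo_of_wall stub_wallRankZeroAtTwo.1 stub_wallRankZeroAtTwo.2.1 stub_wallRankZeroAtTwo.2.2.1 stub_wallRankZeroAtTwo.2.2.2)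
    stub_heegnerIndexUpper stub_heegnerIndexLower
    stub_printFacts.1 stub_printFacts.2.1 stub_printFacts.2.2.1 stub_printFacts.2.2.2.1 stub_printFacts.2.2.2.2.1 stub_printFacts.2.2.2.2.2

end Summit.BirchSwinnertonDyer.BirchSwinnertonDyer.Cruxes.MinimalTwinBSDTwo.TwinSwapV26
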